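import Summits.AtomisticToContinuum.FouriersLaw.Theses.CoercivePulse
import Summits.AtomisticToContinuum.FouriersLaw.Theorems.CoercivePulseLinearSpreadOfBridge
import Summits.AtomisticToContinuum.FouriersLaw.Theorems.CoercivePulseFouriersLawOfBridge

/-!
# Skeleton of crux `CoercivePulse.LinearSpread` (stmt-AtomisticToContinuum-15382) — line `KaramataCollapse`, END OF CYCLE 1:
# everything but the two EXISTING bridge items is LANDED; the composition itself is the tree theorem `linearSpread_of_bridge`

Crux (route `route-AtomisticToContinuum-CoercivePulse`, rank 2): for the guarded infinite pinned anharmonic chain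
(`ω₂, lam, β > 0`, shift- and momentum-reversal-invariant DLR state `μ` at `T > 0`, `μ`-preserving a.e.
shift-covariant dynamics `D`, split-bond site energy `h`, pulse `S(x,t) = Cov(h_0, h_x ∘ φ_t)` with
`Σ_x (1+x²)|S(x,t)| < ∞`), there are `m > 0`, `t₂` with `m·t ≤ M(t) := Σ_x x² S(x,t)` for all `t ≥ t₂`.

## The line (idea card `Ideas/subadditive-karamata-collapse.md`, heat-variance / spectral form) — state after cycle 1

LANDED by this lead (all `--supports stmt-AtomisticToContinuum-15382`, axioms propext/Classical.choice/Quot.sound):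
* `stub_karamataCollapse` (p166369, `Theorems/CoercivePulseLinearSpreadStubKaramataCollapse.lean`) — the Tauberian collapse:
  `f = σ² ≥ 0`, `|σ(t) − σ(s)| ≤ σ(t−s)`, linear ceiling, Laplace integrability, Abel regularity, `f ≥ m₀t` infinitely often ⇒
  `f ≥ m·t` eventually (Karamata index 2 over the proved `karamata_tauberian_laplace_two`);
* `stub_spectralIncrements` (p166798, `…StubSpectralIncrements.lean`) — `|√V(t) − √V(s)| ≤ √V(t−s)` for the spectral heat variance of a
  finite measure (Minkowski in `L²(ρ)`);
* `stub_helfandIdentity` (p166976, `…StubHelfandIdentity.lean`) — Helfand in the time domain, `M(t) − M(0) = V(t) := 2∫_{(0,t]}(t−s)C_T`;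
* `stub_abelRegularityOfRegularity`, `stub_abelFloorOfBridge` (p167641, `…BridgeAbelData.lean`) — (R) ⇒ `CoercivePulse.AbelRegularity`
  (the Abel means of every guarded pair are CAUCHY at `0⁺`: (R) with tolerance at two frequencies + fixed-frequency matching), and
  (R) ∧ CLB ⇒ a bulk Abel floor `a ≤ Â(ν)` on `(0,ν₀)` (KDN open-chain Green–Kubo identity + CLB + (R) at `ε = cT²/4` + matching);
* `linearSpread_of_bridge` (p167884, `Theorems/CoercivePulseLinearSpreadOfBridge.lean`) — THE COMPOSITION, sorry-free:
  `UniformAbelianRegularity → ConductanceLowerBound → LinearSpread` (heat-variance calculus + Helfand–Bochner measure landed by other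
  seats; ceiling from (R) via the LinearCeiling lead's `linearCeiling_of_uniformAbelianRegularity`; regularity from (R); floor from
  (R)+CLB turned into infinitely-often linear growth by the Abelian lemma `io_of_abelFloor`; increments; Karamata collapse; Helfand);
* `fouriersLaw_of_bridge` (p167957, `Theorems/CoercivePulseFouriersLawOfBridge.lean`) — route-level record:
  `UniformAbelianRegularity → ConductanceLowerBound → FouriersLaw` (the Abelian witness built from (R), CLB, the proved `SymmetricSetup` and
  `HeatVarianceCalculus`; the route's pulse cruxes and `PulseCalculus` are not needed for the conjunct).

OPEN stubs = the two EXISTING gen-1 children of the shared bridge `AbelThermodynamicLimit`: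
* `stub_uniformAbelianRegularity` := `CoercivePulse.UniformAbelianRegularity` (item stmt-AtomisticToContinuum-13416) BY NAME;
* `stub_conductanceLowerBound` := `CoercivePulse.ConductanceLowerBound` (item stmt-AtomisticToContinuum-11749) BY NAME.
With the landed converse `conductanceLowerBound_of_linearSpread` (p157637): modulo (R), `LinearSpread ⟺ CLB`. When both items close,
the closing file is one line: `theorem linearSpread_proof : LinearSpread := linearSpread_of_bridge ‹R› ‹CLB›`.
-/

noncomputable section

namespace Summit.AtomisticToContinuum.FouriersLaw.Cruxes.LinearSpread.KaramataCollapse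

/-! ## Part I — the two open stubs (existing items; the ONLY `sorry`s) -/

/-- **Stub — `uniformAbelianRegularity`** := (R) = `CoercivePulse.UniformAbelianRegularity` (item stmt-AtomisticToContinuum-13416) BY
NAME: the low-frequency part of the open chain's equilibrium current autocorrelation carries `o(N)` weight uniformly. Closed by whoever
closes stmt-13416. -/
theorem Holds.stub_uniformAbelianRegularity :
    Summit.AtomisticToContinuum.FouriersLaw.Theses.CoercivePulse.UniformAbelianRegularity := by
  sorry

/-- **Stub — `conductanceLowerBound`** := CLB = `CoercivePulse.ConductanceLowerBound` (item stmt-AtomisticToContinuum-11749) BY NAME: an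
Ohmic lower bound `D_N ≥ c > 0` on the open chain's response coefficients, eventually in `N`. Closed by whoever closes stmt-11749. -/
theorem Holds.stub_conductanceLowerBound :
    Summit.AtomisticToContinuum.FouriersLaw.Theses.CoercivePulse.ConductanceLowerBound := by
  sorry

/-- Statement of the open stub (R), by name. -/
def stub_uniformAbelianRegularity : Prop := type_of% Holds.stub_uniformAbelianRegularity

/-- Statement of the open stub CLB, by name. -/
def stub_conductanceLowerBound : Prop := type_of% Holds.stub_conductanceLowerBound

/-! ## Part II — the skeleton theorem (sorry-free; the composition is the landed `linearSpread_of_bridge`) -/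

/-- **`LinearSpread_of`** — `stub_uniformAbelianRegularity → stub_conductanceLowerBound → CoercivePulse.LinearSpread`, by the landed
composition `Theorems.LinearSpread.KaramataCollapse.linearSpread_of_bridge` (p167884). [folklore] -/
theorem LinearSpread_of (hR : stub_uniformAbelianRegularity) (hC : stub_conductanceLowerBound) :
    Summit.AtomisticToContinuum.FouriersLaw.Theses.CoercivePulse.LinearSpread :=
  Summit.AtomisticToContinuum.FouriersLaw.Theorems.LinearSpread.KaramataCollapse.linearSpread_of_bridge hR hC

/-- Route-level corollary recorded next to the skeleton: the same two stubs give the CONJUNCT (`fouriersLaw_of_bridge`, p167957). -/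
example (hR : stub_uniformAbelianRegularity) (hC : stub_conductanceLowerBound) : _root_.FouriersLaw :=
  Summit.AtomisticToContinuum.FouriersLaw.Theorems.LinearSpread.KaramataCollapse.fouriersLaw_of_bridge hR hC

/-- D-0027 §3.3 shape: the crux from the registered stubs (an `example`; it becomes a proof once the two items close). -/
example : Summit.AtomisticToContinuum.FouriersLaw.Theses.CoercivePulse.LinearSpread :=
  LinearSpread_of Holds.stub_uniformAbelianRegularity Holds.stub_conductanceLowerBound

end Summit.AtomisticToContinuum.FouriersLaw.Cruxes.LinearSpread.KaramataCollapse

end
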